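import Summits.Ventures.PercRepro.RankLevelSetBigFlatTail

/-!
# PercRepro — THE CONCENTRATED SPANNING TAIL OF A BIG RANK-`≤ 7` SET, WITH ITS SIZE KEPT (p9, gen 29; S4 — the giant-term
band of the rows `≤ 36` of the `q = 7` window)

`ncard_spanning_le_bigflat` (RankLevelSetBigFlatTail) bounds the spanning sets by `Σ_{m ≤ d} Σ_{j ∈ [m − 9, m]} C(79, j)·C(p + 2, m − j)`
— the two factors at their separate worst cases (`|W| ≤ 79`, `|E ∖ W| ≤ p + 2`), which is too crude two rows down
(at `(36, 68 … 70)` it exceeds the room). **`ncard_spanning_le_bigflat_w`** keeps the size `w = |W|`: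
`#spanning ≤ Σ_{m ≤ d} Σ_{j ∈ [m − 9, m]} C(w, j)·C(p + d − w, m − j)` — the cells then take the maximum over the thirteen
values `d − 2 ≤ w ≤ 79` (at `w = 79`, where `2^w` wins over `C(p + d − w, ≤ 9)`) by `interval_cases w` and `decide +kernel`.
Axioms: standard.
-/

open scoped Matroid

namespace PercRepro

namespace ThmN

open Set

variable {α : Type}

/-- **The concentrated spanning tail of a big rank-`≤ 7` set, with its size**: if `W ⊆ E` has rank `≤ 7` and
`d − 2 ≤ |W|` in a finite matroid of rank `p` with `|E| = p + d`, then the spanning sets number at most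
`Σ_{m ≤ d} Σ_{j ∈ [m − 9, m]} C(|W|, j)·C(p + d − |W|, m − j)` (p7 g12's `S2.ncard_spanning_le_of_nullity` at `W`,
whose nullity is `≥ d − 9`). -/
theorem ncard_spanning_le_bigflat_w (M : Matroid α) [M.Finite] {p d : ℕ} (hR : M.eRank = (p : ℕ∞))
    (hn : M.E.ncard = p + d) {W : Set α} (hW : W ⊆ M.E) (hr : M.eRk W ≤ 7) (hbig : d - 2 ≤ W.ncard) :
    {X : Set α | X ⊆ M.E ∧ M.eRk X = M.eRank}.ncard ≤
      ∑ m ∈ Finset.range (d + 1), ∑ j ∈ Finset.Icc (m - 9) m,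
        W.ncard.choose j * (p + d - W.ncard).choose (m - j) := by
  have hd : M.E.encard = M.eRank + d := by
    rw [hR, ← M.ground_finite.cast_ncard_eq, hn]
    push_cast
    ring
  have hWfin : W.Finite := M.ground_finite.subset hW
  have hne : M.eRk W ≠ ⊤ := ((M.eRk_le_encard _).trans_lt hWfin.encard_lt_top).ne
  obtain ⟨r, hr'⟩ := ENat.ne_top_iff_exists.1 hne
  have hrW : r ≤ W.ncard := by
    have := M.eRk_le_encard W
    rw [← hr', ← hWfin.cast_ncard_eq] at this
    exact_mod_cast this
  have hr7 : r ≤ 7 := by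
    rw [← hr'] at hr
    exact_mod_cast hr
  have hk : W.encard = M.eRk W + (W.ncard - r) := by
    rw [← hr', ← hWfin.cast_ncard_eq]
    have : W.ncard = r + (W.ncard - r) := by omega
    conv_lhs => rw [this]
    push_cast
    rfl
  refine (S2.ncard_spanning_le_of_nullity M hW hd hk).trans ?_
  rw [hn]
  refine Finset.sum_le_sum fun m _ => ?_
  refine Finset.sum_le_sum_of_subset_of_nonneg ?_ fun _ _ _ => Nat.zero_le _
  intro j hj
  rw [Finset.mem_Icc] at hj ⊢
  omega

end ThmN

end PercRepro
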